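import Summits.CriticalPhenomena.Ising3DConformalLimit.Theorems.HarmonicMomentsIsotropyTwoPointAsymptoticIsotropy

/-!
# Route HarmonicMomentsIsotropy — the support item `DilutionTransfer` (stmt-CriticalPhenomena-6037)

`DilutionTransfer` is the glue
`HarmonicDilution → CorrelationLengthWindow → ExistsScaleCovariantLimit → TwoPointAsymptoticIsotropy`
(formulas inlined in the route file). Its third hypothesis alone already gives the conclusion: the
accepted theorem `twoPointAsymptoticIsotropy_of_existsScaleCovariantLimit :
ExistsScaleCovariantLimit → TwoPointAsymptoticIsotropy`
(`Theorems/HarmonicMomentsIsotropyTwoPointAsymptoticIsotropy.lean`, p115280; lattice-to-continuum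
transfer by Riemann sums + nine-mirror reflection-positivity rigidity `HRP2Rigidity_of`) is the
transfer without the harmonic-dilution and `ξ₂`-window inputs. Hence the item is a one-line corollary;
the two unused hypotheses are discarded. No Karamata / Carleman argument is needed.

No definitions, no named facts; axioms standard.
-/

namespace Summit.CriticalPhenomena.Ising3DConformalLimit.HarmonicMomentsIsotropyTwoPoint

open Summit.CriticalPhenomena.Ising3DConformalLimit.Theses.HarmonicMomentsIsotropy

/-- **Item stmt-CriticalPhenomena-6037 (`DilutionTransfer`), proved.** The route decl verbatim:
`HarmonicDilution` (inlined) `→ CorrelationLengthWindow → ExistsScaleCovariantLimit →`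
(the formula of `TwoPointAsymptoticIsotropy`). Only the scale-covariant-limit hypothesis is used
(`twoPointAsymptoticIsotropy_of_existsScaleCovariantLimit`). -/
theorem dilutionTransfer_proof : DilutionTransfer := by
  intro _ _ hEX
  exact twoPointAsymptoticIsotropy_of_existsScaleCovariantLimit hEX

end Summit.CriticalPhenomena.Ising3DConformalLimit.HarmonicMomentsIsotropyTwoPoint
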